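import Summits.BirchSwinnertonDyer.BirchSwinnertonDyer.Theorems.ByReductionTypeAtTwoSupersingularFlatBlindHondaWronskianAtTwo
import Summits.BirchSwinnertonDyer.BirchSwinnertonDyer.Theorems.ByReductionTypeAtTwoSupersingularFlatColemanClauses
import Literature.NumberTheory.EllipticCurves.Sprung2012.ColemanMapJointCokernelProofs
import HarnessLib

/-!
# Route `ByReductionTypeAtTwo` (rung K4), crux `SupersingularRankZeroAtTwo` (item stmt-BirchSwinnertonDyer-19097):
# **THE WRONSKIAN SLOPE AT `p = 2` IS A FIRST-LAYER DETERMINANT** — slot 5's Honda rung CDF±_H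
# (`OddBlindPackage.FlatBlindLocalTransversalityHondaOffZeroAtTwo`, line v2.6.1 18db34093d095bfe :898) follows from ONE
# mod-2 INDEPENDENCE of two explicit points of the local tower: `c₋` and `g·c₁` — seat `bsd-2adic-ss-1`, GEN 19, LEAD attack
# (L3), part 4 (sequel of p810801 (Y), p810939 (K₈), p811031 (D₁))

HONEST FRAMING (cell `bsd-2adic`): THEOREMS ONLY; no definition, no named fact, no `sorry`, no instance.  Nothing booked
(D-0054); BSD is not proved by any of this; the independence statement (IND₁) itself is NOT proved here — it is the residual,
a RANK-type input which the dual generation clauses of `IsHondaSystemAtTwo` do not supply (the `p = 2` twin, at layer ONE, of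
the tree's odd-`p` residual `π : E(ℚ_{p,2}) ↠ ℤ_p^{p²}` of `Sprung2012/HondaOrbitRankOfSurjectiveProofs.lean`).  PARTITION: X5@2
good-ss r₀, `a₂ = ±2` × p = 2 — types-the-object-of; closes none. bears_on: K4 (item 19097).

## What is proved

* §1 ★ `two_dvd_coeff_one_wronskian_sub_det` — THE `p = 2` SLOPE FORMULA: for a Honda system at two with EVEN parameter `a`
  and two functionals `z₀, z₁` with Coleman values `(a₀, b₀)`, `(a₁, b₁)`:
  `coeff₁(a₀b₁ − a₁b₀) ≡ z₀(c₋)·z₁(g·c₁) − z₁(c₋)·z₀(g·c₁) (mod 2)`.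
  Ingredients: the constant-term line `(a_i(0), b_i(0)) = −z_i(c₋)(λ, μ)` (p811031) with `λ` EVEN and `μ` ODD for even `a`,
  and the tree's level-one congruence `IsColemanPair.natCast_dvd_coeff_one_sharp_add` (any `p`; at `p = 2`:
  `coeff₁ a_i ≡ −z_i(g·c₁)`).  At odd `p` the ♭-side and the level-`2` point `q` carry the slope (tree
  `IsColemanPair.wronskian_constantCoeff_eq_zero_and_dvd`); at `p = 2` the ♭-terms die with `λ ≡ 0` and the slope is read at
  LAYER ONE.
* §2 ★ `exists_oddSlope_of_independent` — (IND₁) «`c₋` and `g·c₁` are `𝔽₂`-independent in `E(K_∞·K_v)/2`» ⟹ (D₁): two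
  functionals with odd Wronskian slope (two-point separation `Sprung2012.exists_addMonoidHom_pair_det_not_dvd` + Coleman values
  `SSFlatEC.exists_isColemanPair_of_trace`).
* §3 ★★ `flatBlindLocalTransversalityHondaOffZeroAtTwo_of_independent` — over `ℚ`: **(IND₁) ⟹ CDF±_H**, the rung's body
  VERBATIM (via p811031 `…_of_oddSlope`, p810939 `…_of_kernelValue`).
Net after this file: CDF±_H ⟸ (IND₁) «for every Honda system at two (a₂ ≠ 0): `2y = m₁c₋ + m₂(g·c₁)` in `E(ℚ_{∞,v})` forces
`m₁, m₂` even».  In the two-generation model `E(ℚ_{1,v}) = ℤ₂c₋ ⊕ ℤ₂y₀` (`y₀ = c₁ − ½λc₋`, `g·c₁ = ½λc₋ − y₀`, `½λ` odd), so (IND₁)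
holds; it is NOT derivable from the dual clauses + (NT) (a tower with 2-divisible ψ₂-line satisfies them all).

## References
* [Sprung2012] F. Sprung, J. Number Theory 132 (2012): Thm. 2.2, Lemma 2.3 (p. 1487), Def. 3.1 (p. 1489), Def. 5.9 (p. 1495),
  Def. 7.1–7.2 (p. 1500), Def. 7.9 (p. 1503).
* [Sprung2017] F. Sprung, ANT 11 (2017), Cor. 4.4 (`u₁ = 1`, `v₁ = 0`).
* [KuriharaPollack2007] Prop. 1.2 (SES-KP).
* Tree: `Sprung2012/{ColemanMapLevelCongruenceProofs (natCast_dvd_coeff_one_sharp_add), ColemanMapJointCokernelProofs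
  (exists_addMonoidHom_pair_det_not_dvd), HondaOrbitRankOfSurjectiveProofs (odd-p rank residual)}.lean`,
  `Theorems/ByReductionTypeAtTwoSupersingularFlatColemanClauses.lean` (`SSFlatEC.exists_isColemanPair_of_trace`), p811031, p810939.
-/

set_option autoImplicit false
set_option linter.dupNamespace false

noncomputable section

open scoped Classical NumberField

universe u

namespace Summit.BirchSwinnertonDyer.BirchSwinnertonDyer.Theorems

namespace OddBlindLocal

open NumberField IsDedekindDomain Literature.NumberTheory.EllipticCurves Literature.NumberTheory.GaloisRepresentations
  ZpExtension Literature.NumberTheory.EllipticCurves.Kobayashi2003 Literature.NumberTheory.EllipticCurves.Sprung2017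
  Literature.NumberTheory.EllipticCurves.Sprung2012 Literature.NumberTheory.EllipticCurves.Rank1Residual
  Summit.BirchSwinnertonDyer.Rank1Residual.F1Sign2 Summit.BirchSwinnertonDyer.Rank1Residual.Supersingular.BlindLever

/-! ## §1 The slope formula at `p = 2` -/

/-- `coeff₁(φψ) = φ(0)·coeff₁ψ + coeff₁φ·ψ(0)`. [folklore] -/
theorem coeff_one_mul_eq (φ ψ : IwasawaAlgebra 2) :
    PowerSeries.coeff 1 (φ * ψ) =
      PowerSeries.constantCoeff φ * PowerSeries.coeff 1 ψ + PowerSeries.coeff 1 φ * PowerSeries.constantCoeff ψ := by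
  rw [PowerSeries.coeff_mul, Finset.Nat.sum_antidiagonal_eq_sum_range_succ
    (fun i j => PowerSeries.coeff i φ * PowerSeries.coeff j ψ) 1, Finset.sum_range_succ, Finset.sum_range_one, Nat.sub_zero,
    Nat.sub_self, PowerSeries.coeff_zero_eq_constantCoeff_apply, PowerSeries.coeff_zero_eq_constantCoeff_apply]

section Generic

variable {K : Type u} [Field K] {κ : ZpExtension K 2}
variable {E : Type u} [Field E] [Algebra K E] {ι : AlgebraicClosure K →ₐ[K] AlgebraicClosure E}
variable {W : WeierstrassCurve K}

/-- **Level one at `p = 2`: `coeff₁ Col♯(z) ≡ −z(g·c₁) (mod 2)`** — the tree's `IsColemanPair.natCast_dvd_coeff_one_sharp_add`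
(`p ∣ coeff₁L♯ + ∑_{j<p} j·z(gʲc₁)`) read at `p = 2`. [cite: Sprung2012, Def. 5.9 (p. 1495), Def. 7.2 (p. 1500)] -/
theorem two_dvd_coeff_one_sharp_add {a : ℤ} {g : Field.absoluteGaloisGroup E} {c : ℕ → localPoints W E}
    (hc1 : c 1 ∈ localTowerPointsOfEmb κ ι W) {z : localTowerPointsOfEmb κ ι W →+ ℤ_[2]} {A B : IwasawaAlgebra 2}
    (hz : IsColemanPair κ ι W a g c z A B) :
    (2 : ℤ_[2]) ∣ PowerSeries.coeff 1 A + z ⟨g • c 1, smul_mem_localTowerPointsOfEmb κ ι W g hc1⟩ := by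
  have h := hz.natCast_dvd_coeff_one_sharp_add
  rw [Finset.sum_range_succ, Finset.sum_range_one, Nat.cast_zero, zero_mul, zero_add, Nat.cast_one, one_mul, pow_one,
    evalOn_of_mem W _ z (smul_mem_localTowerPointsOfEmb κ ι W g hc1)] at h
  exact_mod_cast h

/-- ★ **THE `p = 2` WRONSKIAN SLOPE FORMULA.**  For a Honda system at two `(c₋, c)` with EVEN parameter `a`, `g` a local lift of
the topological generator, and functionals `z₀, z₁` with Coleman values `(a₀, b₀)`, `(a₁, b₁)`:
`2 ∣ coeff₁(a₀b₁ − a₁b₀) − (z₀(c₋)·z₁(g·c₁) − z₁(c₋)·z₀(g·c₁))`.  From `(a_i(0), b_i(0)) = −z_i(c₋)(λ, μ)` (`λ = a(a²−2a−1) + 4 − 2a`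
even, `μ = a² − 2a − 1` odd) and `coeff₁a_i ≡ −z_i(g·c₁)`: `coeff₁W = λ(…) + μ(z₀(c₋)coeff₁a₁ − z₁(c₋)coeff₁a₀)`.
[cite: Sprung2012, Def. 5.9 (p. 1495), Def. 7.2 (p. 1500), Thm. 2.2 (p. 1487)] [cite: KuriharaPollack2007, Prop. 1.2] -/
theorem two_dvd_coeff_one_wronskian_sub_det {a : ℤ} (hap : (2 : ℤ) ∣ a) {g : Field.absoluteGaloisGroup E}
    (hg : κ.IsTopGenerator (resGalOfEmb ι g)) {cneg : localPoints W E} {c : ℕ → localPoints W E}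
    (hH : IsHondaSystemAtTwo κ ι W a g cneg c)
    {z₀ z₁ : localTowerPointsOfEmb κ ι W →+ ℤ_[2]} {a₀ b₀ a₁ b₁ : IwasawaAlgebra 2}
    (h₀ : IsColemanPair κ ι W a g c z₀ a₀ b₀) (h₁ : IsColemanPair κ ι W a g c z₁ a₁ b₁) :
    (2 : ℤ_[2]) ∣ PowerSeries.coeff 1 (a₀ * b₁ - a₁ * b₀) -
      (z₀ ⟨cneg, localLayerPointsOfEmb_le_localTowerPointsOfEmb κ ι W 0 hH.1⟩ *
          z₁ ⟨g • c 1, smul_mem_localTowerPointsOfEmb κ ι W g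
            (localLayerPointsOfEmb_le_localTowerPointsOfEmb κ ι W 1 (hH.2.1 1))⟩ -
        z₁ ⟨cneg, localLayerPointsOfEmb_le_localTowerPointsOfEmb κ ι W 0 hH.1⟩ *
          z₀ ⟨g • c 1, smul_mem_localTowerPointsOfEmb κ ι W g
            (localLayerPointsOfEmb_le_localTowerPointsOfEmb κ ι W 1 (hH.2.1 1))⟩) := by
  have hc1 : c 1 ∈ localTowerPointsOfEmb κ ι W := localLayerPointsOfEmb_le_localTowerPointsOfEmb κ ι W 1 (hH.2.1 1)
  obtain ⟨ha₀, hb₀⟩ := constantCoeff_eq_of_isHondaSystemAtTwo hg hH h₀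
  obtain ⟨ha₁, hb₁⟩ := constantCoeff_eq_of_isHondaSystemAtTwo hg hH h₁
  obtain ⟨s₀, hs₀⟩ := two_dvd_coeff_one_sharp_add hc1 h₀
  obtain ⟨s₁, hs₁⟩ := two_dvd_coeff_one_sharp_add hc1 h₁
  obtain ⟨a', rfl⟩ := hap
  -- abbreviations for the values
  set ℓ₀ := z₀ ⟨cneg, localLayerPointsOfEmb_le_localTowerPointsOfEmb κ ι W 0 hH.1⟩
  set ℓ₁ := z₁ ⟨cneg, localLayerPointsOfEmb_le_localTowerPointsOfEmb κ ι W 0 hH.1⟩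
  set G₀ := z₀ ⟨g • c 1, smul_mem_localTowerPointsOfEmb κ ι W g hc1⟩
  set G₁ := z₁ ⟨g • c 1, smul_mem_localTowerPointsOfEmb κ ι W g hc1⟩
  have e₀ : PowerSeries.coeff 1 a₀ = 2 * s₀ - G₀ := by linear_combination hs₀
  have e₁ : PowerSeries.coeff 1 a₁ = 2 * s₁ - G₁ := by linear_combination hs₁
  rw [map_sub, coeff_one_mul_eq, coeff_one_mul_eq, ha₀, hb₀, ha₁, hb₁, e₀, e₁]
  push_cast
  exact ⟨(a' * ((2 * a') ^ 2 - 2 * (2 * a') - 1) + 2 - 2 * a') * (ℓ₁ * PowerSeries.coeff 1 b₀ - ℓ₀ * PowerSeries.coeff 1 b₁) +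
      ((2 * a') ^ 2 - 2 * (2 * a') - 1) * (s₁ * ℓ₀ - s₀ * ℓ₁) + (2 * a' ^ 2 - 2 * a') * (G₀ * ℓ₁ - G₁ * ℓ₀), by ring⟩

/-! ## §2 (IND₁) ⟹ (D₁): independence of `c₋, g·c₁` modulo `2` gives an odd slope -/

/-- ★ **(IND₁) ⟹ (D₁).**  (NT) no `2`-torsion in `E(K_∞·K_v)`; `(c₋, c)` a Honda system at two with even parameter `a`; `g` a local
lift of the topological generator; and (IND₁): whenever `2y = m₁c₋ + m₂(g·c₁)` with `y ∈ E(K_∞·K_v)`, both `m₁, m₂` are even.  Then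
SOME two functionals `z₀, z₁` on `E(K_∞·K_v)` have Coleman values with ODD Wronskian slope `coeff₁(a₀b₁ − a₁b₀)`: two-point separation
(`exists_addMonoidHom_pair_det_not_dvd`) gives `z₀, z₁` with odd determinant of values at `(c₋, g·c₁)`; every functional has a Coleman
value (`SSFlatEC.exists_isColemanPair_of_trace`, from (L)(TR)); §1. [cite: Sprung2012, Lemma 2.3 (p. 1487), Def. 5.9 (p. 1495)]
[cite: KuriharaPollack2007, Prop. 1.2] -/
theorem exists_oddSlope_of_independent
    (hnt : ∀ P ∈ localTowerPointsOfEmb κ ι W, 2 • P = 0 → P = 0)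
    {a : ℤ} (hap : (2 : ℤ) ∣ a) {g : Field.absoluteGaloisGroup E} (hg : κ.IsTopGenerator (resGalOfEmb ι g))
    {cneg : localPoints W E} {c : ℕ → localPoints W E} (hH : IsHondaSystemAtTwo κ ι W a g cneg c)
    (hind : ∀ (m₁ m₂ : ℤ) (y : localPoints W E), y ∈ localTowerPointsOfEmb κ ι W →
      2 • y = m₁ • cneg + m₂ • (g • c 1) → (2 : ℤ) ∣ m₁ ∧ (2 : ℤ) ∣ m₂) :
    ∃ (z₀ z₁ : localTowerPointsOfEmb κ ι W →+ ℤ_[2]) (a₀ b₀ a₁ b₁ : IwasawaAlgebra 2),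
      IsColemanPair κ ι W a g c z₀ a₀ b₀ ∧ IsColemanPair κ ι W a g c z₁ a₁ b₁ ∧
        ¬ (2 : ℤ_[2]) ∣ PowerSeries.coeff 1 (a₀ * b₁ - a₁ * b₀) := by
  have hle := fun n ↦ localLayerPointsOfEmb_le_localTowerPointsOfEmb κ ι W n
  have hc1 : c 1 ∈ localTowerPointsOfEmb κ ι W := hle 1 (hH.2.1 1)
  set x₁ : localTowerPointsOfEmb κ ι W := ⟨cneg, hle 0 hH.1⟩ with hx₁
  set x₂ : localTowerPointsOfEmb κ ι W := ⟨g • c 1, smul_mem_localTowerPointsOfEmb κ ι W g hc1⟩ with hx₂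
  have hN' : ∀ y : localTowerPointsOfEmb κ ι W, 2 • y = 0 → y = 0 := fun y hy ↦
    Subtype.ext (hnt y y.2 (by rw [← AddSubgroupClass.coe_nsmul, hy]; rfl))
  have hind' : ∀ (m₁ m₂ : ℤ) (y : localTowerPointsOfEmb κ ι W), 2 • y = m₁ • x₁ + m₂ • x₂ →
      (2 : ℤ) ∣ m₁ ∧ (2 : ℤ) ∣ m₂ := fun m₁ m₂ y hy ↦
    hind m₁ m₂ y y.2 (by
      have h := congrArg (fun t : localTowerPointsOfEmb κ ι W ↦ (t : localPoints W E)) hy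
      simpa only [AddSubgroupClass.coe_nsmul, AddMemClass.coe_add, AddSubgroupClass.coe_zsmul] using h)
  obtain ⟨z₀, z₁, hdet⟩ := exists_addMonoidHom_pair_det_not_dvd (p := 2) hN' hind'
  obtain ⟨a₀, b₀, h₀⟩ := SSFlatEC.exists_isColemanPair_of_trace κ ι W hg hap hH.2.1 hH.2.2.2.2.1 z₀
  obtain ⟨a₁, b₁, h₁⟩ := SSFlatEC.exists_isColemanPair_of_trace κ ι W hg hap hH.2.1 hH.2.2.2.2.1 z₁
  refine ⟨z₀, z₁, a₀, b₀, a₁, b₁, h₀, h₁, fun h2 ↦ hdet ?_⟩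
  have hslope := two_dvd_coeff_one_wronskian_sub_det hap hg hH h₀ h₁
  have h := dvd_sub h2 hslope
  rw [sub_sub_cancel] at h
  have h2c : ((2 : ℕ) : ℤ_[2]) = 2 := by norm_num
  rw [h2c]
  exact h

end Generic

/-! ## §3 Over `ℚ` at `v ∋ 2`: (IND₁) ⟹ CDF±_H, the rung's body VERBATIM -/

section Rat

/-- ★★ **(IND₁) ⟹ CDF±_H.**  If for every Honda system at two `(c₋, c)` (`W/ℚ` globally minimal, `GoodSS W 2`, `a₂ ≠ 0`, `κ` cyclotomic,
`v ∋ 2`, `g` a local lift of the topological generator) the points `c₋` and `g·c₁` are `𝔽₂`-INDEPENDENT in `E(ℚ_{∞,v})/2E(ℚ_{∞,v})`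
(«`2y = m₁c₋ + m₂(g·c₁)` forces `m₁, m₂` even» — a first-layer RANK statement: in the two-generation model `E(ℚ_{1,v}) = ℤ₂c₋ ⊕ ℤ₂y₀`
with `g·c₁ = ½λc₋ − y₀`, `½λ` odd), then slot 5's Honda rung CDF±_H holds: (IND₁) ⟹ (D₁) odd Wronskian slope (§2, with (NT) =
`SignedIntersection.noTwoTorsion_localTowerPointsOfEmb_adicCompletion` and `2 ∣ a₂` from `GoodSS`) ⟹ (K₈) (p811031) ⟹ CDF±_H (p810939).
The conclusion is VERBATIM the body of `OddBlindPackage.FlatBlindLocalTransversalityHondaOffZeroAtTwo` (v2.6.1 :898–925).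
[cite: Sprung2012, Thm. 2.2, Lemma 2.3 (p. 1487), Def. 7.9 (p. 1503), Open Problem 7.22 (p. 1505)] [cite: KuriharaPollack2007, Prop. 1.2] -/
theorem flatBlindLocalTransversalityHondaOffZeroAtTwo_of_independent
    (hI : ∀ (W : WeierstrassCurve ℚ) [W.IsElliptic] [W.IsGloballyMinimal],
      GoodSS W 2 → W.frobeniusTrace 2 ≠ 0 →
      ∀ (κ : ZpExtension ℚ 2), κ.IsCyclotomic →
      ∀ (v : HeightOneSpectrum (𝓞 ℚ)), (2 : 𝓞 ℚ) ∈ v.asIdeal →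
      ∀ (g : Field.absoluteGaloisGroup (v.adicCompletion ℚ))
        (cneg : localPoints W (v.adicCompletion ℚ)) (c : ℕ → localPoints W (v.adicCompletion ℚ)),
        κ.IsTopGenerator (resGalOfEmb (closureEmb (K := ℚ) (v.adicCompletion ℚ)) g) →
        Summit.BirchSwinnertonDyer.Rank1Residual.F1Sign2.IsHondaSystemAtTwo κ (closureEmb (K := ℚ) (v.adicCompletion ℚ)) W
          (W.frobeniusTrace 2) g cneg c →
        ∀ (m₁ m₂ : ℤ) (y : localPoints W (v.adicCompletion ℚ)),
          y ∈ localTowerPointsOfEmb κ (closureEmb (K := ℚ) (v.adicCompletion ℚ)) W →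
          2 • y = m₁ • cneg + m₂ • (g • c 1) → (2 : ℤ) ∣ m₁ ∧ (2 : ℤ) ∣ m₂) :
    ∀ (W : WeierstrassCurve ℚ) [W.IsElliptic] [W.IsGloballyMinimal],
    ¬ W.HasCM → GoodSS W 2 → W.frobeniusTrace 2 ≠ 0 → W.rootNumber * ZMod.χ₈ (W.conductorNorm ℤ : ZMod 8) = -1 →
    ∀ (κ : ZpExtension ℚ 2) (γ : Field.absoluteGaloisGroup ℚ),
      κ.IsCyclotomic → κ.IsTopGenerator γ → IsCyclotomicVariable 2 γ →
    ∀ (v : HeightOneSpectrum (𝓞 ℚ)), (2 : 𝓞 ℚ) ∈ v.asIdeal →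
    ∀ (g : Field.absoluteGaloisGroup (v.adicCompletion ℚ)) (c : ℕ → localPoints W (v.adicCompletion ℚ)),
      κ.IsTopGenerator (resGalOfEmb (closureEmb (K := ℚ) (v.adicCompletion ℚ)) g) →
      (∀ n, c n ∈ localLayerPointsOfEmb κ (closureEmb (K := ℚ) (v.adicCompletion ℚ)) W n) →
      (∀ n, 1 ≤ n → localTraceOfEmb κ (closureEmb (K := ℚ) (v.adicCompletion ℚ)) W n (n + 1)
        (c (n + 1)) = W.frobeniusTrace 2 • c n - c (n - 1)) →
      (∀ z₀ : localLayerPointsOfEmb κ (closureEmb (K := ℚ) (v.adicCompletion ℚ)) W 0 →+ ℤ_[2],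
        evalOn W (localLayerPointsOfEmb κ (closureEmb (K := ℚ) (v.adicCompletion ℚ)) W 0) z₀ (c 0) = 0 →
          z₀ = 0) →
      (∀ a : ℤ_[2],
        (∃ z₀ : localLayerPointsOfEmb κ (closureEmb (K := ℚ) (v.adicCompletion ℚ)) W 0 →+ ℤ_[2],
          evalOn W (localLayerPointsOfEmb κ (closureEmb (K := ℚ) (v.adicCompletion ℚ)) W 0) z₀ (c 0) = 2 * a) →
        ∃ y : localLayerPointsOfEmb κ (closureEmb (K := ℚ) (v.adicCompletion ℚ)) W 0 →+ ℤ_[2],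
          evalOn W (localLayerPointsOfEmb κ (closureEmb (K := ℚ) (v.adicCompletion ℚ)) W 0) y (c 0) = a) →
      (∃ cneg : localPoints W (v.adicCompletion ℚ),
        Summit.BirchSwinnertonDyer.Rank1Residual.F1Sign2.IsHondaSystemAtTwo κ (closureEmb (K := ℚ) (v.adicCompletion ℚ)) W
          (W.frobeniusTrace 2) g cneg c) →
      ∀ (y : localPoints W (v.adicCompletion ℚ))
        (hy : y ∈ localLayerPointsOfEmb κ (closureEmb (K := ℚ) (v.adicCompletion ℚ)) W 1), g • y = -y →
        ∀ k : ℕ, (∀ w ∈ localLayerPointsOfEmb κ (closureEmb (K := ℚ) (v.adicCompletion ℚ)) W 1, 2 ^ k • w ≠ y) →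
          ∃ z ∈ colemanKer κ (closureEmb (K := ℚ) (v.adicCompletion ℚ)) W (W.frobeniusTrace 2) g c .flat,
            ¬ (2 : ℤ_[2]) ^ (k + 1) ∣
              z ⟨y, localLayerPointsOfEmb_le_localTowerPointsOfEmb κ (closureEmb (K := ℚ) (v.adicCompletion ℚ)) W 1 hy⟩ := by
  refine flatBlindLocalTransversalityHondaOffZeroAtTwo_of_oddSlope fun W _ _ hss ha κ hκ v hv g c hg hc hH ↦ ?_
  obtain ⟨cneg, hH⟩ := hH
  exact exists_oddSlope_of_independent
    (SignedKatoOffTwo.SignedIntersection.noTwoTorsion_localTowerPointsOfEmb_adicCompletion W hss κ v hv _)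
    hss.2 hg hH (hI W hss ha κ hκ v hv g cneg c hg hH)

end Rat

end OddBlindLocal

end Summit.BirchSwinnertonDyer.BirchSwinnertonDyer.Theorems

end
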